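/-
Copyright (c) 2026 the pub-hodgecm-mathlib formalisation cell (harness21).  Prover seat hodgecm-mathlib-K2E3-p37 (g0), Track B «K2-LIT» ∕ h413 =
`stmt-HodgeConjecture-24833`, line `K2_E3_EllipticInputs`, unit U4 «Keys», PART «U4Keys» socket :182 (U4f-χ₁-ram-one-pos)
`sig_K2E3KeysThmTwoContractingRamifiedCharOnePosDepth` (LINE-LEAD K2E3-plan (g4) L4∕E3 EMIT #5 deal D163 2026-09-04T15:31:56Z; R0 census
`K2/K2E3-p37/g0/CENSUS-U4f-PosDepth.K2E3-p37-g0.md`): programme A_pos brick (iv) «THE VANISHING-FUNCTIONAL ENGINE WITH A FAMILY OF IRRELEVANT CELLS» — the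
level-`n` generalisation of ★ `K2E3BranchAContradiction` (K2E3-p06 (g4)).  REPORT-FIRST 2026-09-04.
-/
import Summits.HodgeConjecture.HodgeConjecture.Theorems.K2E3BranchAContradiction   -- ★ Z2A-4 (K2E3-p06 (g4)): `toFun_conj_eq_apply_one`, `toFun_conj_eq_zero`; brings ★ Z2-gen `K2E3TypeVectorSupport`, ★ Z2A-3(5) `integral_conj_ne_zero`
import HarnessLib

/-!
# K2 ∕ E3 «EllipticInputs», unit U4 «Keys» — (U4f-χ₁-ram-one-pos), programme A_pos brick (iv): IN BRANCH A THE INTERTWINING FUNCTIONAL DOES NOT KILL A TYPE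
# VECTOR — CELL-FAMILY FORM «every `w n w` lies in `B` or in an IRRELEVANT cell `H·r·B`, `r ∈ R`; `θ = 1` on `wNw ∩ B` ⟹ `∫_N f(w n w) dn = vol{w n w ∈ B}·f(1) ≠ 0`»
# [Casselman1995 §6.3–§6.4; Roche1998 §3–§4; Keys1984 §3]

Cell hodgecm-mathlib, Track B «K2-LIT», crux item H413 = stmt-HodgeConjecture-24833 (route `HCCMUnconditional`, no route verbs); target BY NAME the OPEN tier-0 leaf
`…K2E3EllipticInputs.U4Keys.sig_K2E3KeysThmTwoContractingRamifiedCharOnePosDepth` (U4Keys ED. 8 :182), design D-I «vanishing functional» at POSITIVE depth.  Author K2E3-p37 (g0).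
`--supports stmt-HodgeConjecture-24833 --as helper`; THEOREMS ONLY (no `def` ∕ `instance` ∕ `notation` ∕ named fact ∕ `sorry`); GENERIC (a topological group `G` with subgroups
`H` (= `P`), `B` (= the level-`n` Iwahori `J_n`), `N`, an element `w`, a one-dimensional `τ`).  NOT THE PAYER of :182.

THE POINT.  ★ `K2E3BranchAContradiction.integral_conj_toFun_ne_zero` (depth zero, `B = I`) needs the DICHOTOMY «`w n w ∈ B ∨ w n w ∈ H·w·B`» for every `n ∈ N` — true for the
Iwahori `I` (★ `K2E3LowerUnipotentBorelIwahori`), FALSE for the level-`n` Iwahori `J_n`, `n ≥ 2`: already in `SL₂`, `ū(c) = [[c⁻¹, 1],[0, c]]·w·u(c⁻¹)` lies in `J_n` iff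
`c ∈ 𝔭ⁿ` and in `P·w·J_n` iff `|c| ≥ 1`, and the INTERMEDIATE cells `P·ū(c)·J_n` (`c ∈ 𝔭ᵏ ∖ 𝔭ᵏ⁺¹`, `1 ≤ k < n`) are neither.  On an intermediate cell a `(J_n, θ)`-type vector
vanishes for a DIFFERENT reason (Roche irrelevance from the depth of `χ₁`: `θ(b_r) ≠ τ(r b_r r⁻¹)` for some `b_r ∈ J_n ∩ r⁻¹ P r`), but the mechanism ★ Z2-gen
`K2E3TypeVectorSupport.toFun_eq_zero_on_doubleCoset` is the same as on the big cell.  THIS FILE therefore restates the engine for an arbitrary FAMILY `R ⊆ G` of cell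
representatives, each with its own disagreement witness: if every `w n w` lies in `B` or in `H·r·B` for some `r ∈ R`, and `θ = 1` on `wNw ∩ B`, then the integrand of
`Λ_w(f) = ∫_N f(w n w) dn` is `f(1)·𝟙_{w n w ∈ B}` and ★ Z2A-3 (5) `integral_conj_ne_zero` gives `Λ_w(f) ≠ 0`; with ★ V1 (`Λ_w|_V = 0` on the reducing `V ∋ f`) this is the
Branch-A contradiction at ANY depth.  The depth-zero engine is the case `R = {w}`.
* §1 `toFun_eq_zero_of_mem_cells` (the type vector vanishes on `⋃_{r ∈ R} H·r·B`).
* §2 **`integral_conj_toFun_ne_zero_of_cells`** (`Λ_w(f) ≠ 0`), **`false_of_typeVector_of_integral_eq_zero_of_cells`** (the contradiction).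
(The singleton family `R = {w}` with the depth-zero dichotomy is exactly ★ `K2E3BranchAContradiction.false_of_typeVector_of_integral_eq_zero` — not restated here.)
HONEST LABEL: HC_CM is proved only modulo the 7 printed citations (2 remaining named inputs: hLiu418 = stmt-HodgeConjecture-24832, h413 = stmt-HodgeConjecture-24833)
until rung 0 closes; count-neutral — this file does NOT pay the leaf; no printed citation is discharged.

## References
* [Casselman1995] W. Casselman, *Introduction to the theory of admissible representations of `p`-adic reductive groups* (1995), §6.3–§6.4 (the functionals `Λ_w`, vectors supported
  on one Bruhat cell).
* [Roche1998] A. Roche, *Types and Hecke algebras for principal series representations of split reductive p-adic groups*, Ann. Sci. ÉNS (4) 31 (1998), §3–§4 (support of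
  `χ̃`-spherical vectors: `P g J` supports one iff `χ̃ = ᵍχ` on `J ∩ g⁻¹Pg`).
* [Keys1984] D. Keys, *Principal series representations of special unitary groups over local fields*, Compositio Math. 51 (1984), §3, §7 Thm (2).
-/

set_option autoImplicit false
-- the mandated namespace repeats the single-problem summit's segment (`HodgeConjecture.HodgeConjecture`)
set_option linter.dupNamespace false

noncomputable section

open MeasureTheory

namespace Summit.HodgeConjecture.HodgeConjecture.Cruxes.H413.K2E3BranchAContradictionCells

open Summit.HodgeConjecture.HodgeConjecture.Cruxes.H413

variable {G : Type*} [Group G] [TopologicalSpace G] [IsTopologicalGroup G] (H : Subgroup G) (τ : Representation ℂ ↥H ℂ)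

/-! ## §1 A type vector vanishes on every irrelevant cell `H·r·B` -/

/-- **On `⋃_{r ∈ R} H·r·B` a `(B, θ)`-eigen-section VANISHES** as soon as every `r ∈ R` carries a disagreement witness `b_r ∈ B` with `r b_r r⁻¹ ∈ H` and
`θ(b_r) ≠ τ(r b_r r⁻¹)` (★ Z2-gen `toFun_eq_zero_on_doubleCoset` cell by cell).  At positive depth `R` = the long Weyl element `w` (Branch-A witness) together with the
intermediate-cell representatives (depth witnesses). [cite: Roche1998, §3–§4] [cite: Casselman1995, §6.3] -/
theorem toFun_eq_zero_of_mem_cells (B : Subgroup G) (θ : G → ℂ) (f : Representation.SmoothInd H τ)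
    (heig : ∀ b ∈ B, Representation.smoothIndRep H τ b f = θ b • f) (R : Set G)
    (hwit : ∀ r ∈ R, ∃ b₀ ∈ B, ∃ hb₀H : r * b₀ * r⁻¹ ∈ H, θ b₀ ≠ τ (⟨r * b₀ * r⁻¹, hb₀H⟩ : ↥H) 1)
    (x : G) (hx : ∃ r ∈ R, ∃ h ∈ H, ∃ b' ∈ B, x = h * r * b') :
    f.toFun x = 0 := by
  obtain ⟨r, hr, h, hh, b', hb', rfl⟩ := hx
  obtain ⟨b₀, hb₀, hb₀H, hne⟩ := hwit r hr
  exact K2E3TypeVectorSupport.toFun_eq_zero_on_doubleCoset H τ B θ f heig r b₀ hb₀ hb₀H hne h hh b' hb'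

/-! ## §2 The functional does not vanish on a type vector (cell-family form) -/

/-- **`Λ_w(f) = ∫_N f(w n w) dn ≠ 0` for a `(B, θ)`-type vector with `f(1) ≠ 0` — CELL-FAMILY FORM.**  Hypotheses: `B` compact open, `N` closed, `w² ∈ B`; `f` is `(B, θ)`-eigen
with `f(1) ≠ 0`; a family `R` of cell representatives, each with a disagreement witness (`θ(b_r) ≠ τ(r b_r r⁻¹)`, `b_r ∈ B`, `r b_r r⁻¹ ∈ H`); the COVERING «`w n w ∈ B` or
`w n w ∈ H·r·B` for some `r ∈ R`» for all `n ∈ N`; `θ = 1` on `wNw ∩ B`; `μ` positive on opens and finite on compacta.  Then the integrand is `f(1)·𝟙_{w n w ∈ B}` (★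
`toFun_conj_eq_apply_one`, §1) and ★ Z2A-3 (5) `integral_conj_ne_zero` concludes. [cite: Casselman1995, §6.4] [cite: Keys1984, §3] [cite: Roche1998, §3–§4] -/
theorem integral_conj_toFun_ne_zero_of_cells (N B : Subgroup G) [MeasurableSpace ↥N] [BorelSpace ↥N] (μ : Measure ↥N) [μ.IsOpenPosMeasure]
    [IsFiniteMeasureOnCompacts μ] (hN : IsClosed (N : Set G)) (hBo : IsOpen (B : Set G)) (hBc : IsCompact (B : Set G))
    (w : G) (hw : w * w ∈ B) (θ : G → ℂ) (f : Representation.SmoothInd H τ)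
    (heig : ∀ b ∈ B, Representation.smoothIndRep H τ b f = θ b • f) (hf1 : f.toFun 1 ≠ 0) (R : Set G)
    (hwit : ∀ r ∈ R, ∃ b₀ ∈ B, ∃ hb₀H : r * b₀ * r⁻¹ ∈ H, θ b₀ ≠ τ (⟨r * b₀ * r⁻¹, hb₀H⟩ : ↥H) 1)
    (hcells : ∀ n : ↥N, w * (n : G) * w ∈ B ∨ ∃ r ∈ R, ∃ h ∈ H, ∃ b' ∈ B, w * (n : G) * w = h * r * b')
    (hθ : ∀ n : ↥N, w * (n : G) * w ∈ B → θ (w * (n : G) * w) = 1) :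
    ∫ n : ↥N, f.toFun (w * (n : G) * w) ∂μ ≠ 0 := by
  refine K2E3VanishingFunctionalLowerCell.integral_conj_ne_zero N B w μ hN hBo hBc hw f.toFun (f.toFun 1) hf1 (fun n hn => ?_) (fun n hn => ?_)
  · exact K2E3BranchAContradiction.toFun_conj_eq_apply_one H τ B θ f heig _ hn (hθ n hn)
  · rcases hcells n with h | h
    · exact absurd h hn
    · exact toFun_eq_zero_of_mem_cells H τ B θ f heig R hwit _ h

/-- **BRANCH-A CONTRADICTION AT ANY DEPTH (cell-family form).**  Same hypotheses with a Haar measure on `N`; if moreover `∫_N f(w n w) dn = 0` (★ V1: the functional `Λ_w`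
kills the `G`-stable `V ∋ f` of a reducible principal series) then `False` — in Branch A the principal series is IRREDUCIBLE, at every depth for which the covering and the
witnesses are supplied. [cite: Casselman1995, §6.4] [cite: Keys1984, §3, §7 Thm (2)] [cite: Roche1998, §3–§4] -/
theorem false_of_typeVector_of_integral_eq_zero_of_cells (N B : Subgroup G) [MeasurableSpace ↥N] [BorelSpace ↥N] (μ : Measure ↥N) [μ.IsHaarMeasure]
    (hN : IsClosed (N : Set G)) (hBo : IsOpen (B : Set G)) (hBc : IsCompact (B : Set G))
    (w : G) (hw : w * w ∈ B) (θ : G → ℂ) (f : Representation.SmoothInd H τ)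
    (heig : ∀ b ∈ B, Representation.smoothIndRep H τ b f = θ b • f) (hf1 : f.toFun 1 ≠ 0) (R : Set G)
    (hwit : ∀ r ∈ R, ∃ b₀ ∈ B, ∃ hb₀H : r * b₀ * r⁻¹ ∈ H, θ b₀ ≠ τ (⟨r * b₀ * r⁻¹, hb₀H⟩ : ↥H) 1)
    (hcells : ∀ n : ↥N, w * (n : G) * w ∈ B ∨ ∃ r ∈ R, ∃ h ∈ H, ∃ b' ∈ B, w * (n : G) * w = h * r * b')
    (hθ : ∀ n : ↥N, w * (n : G) * w ∈ B → θ (w * (n : G) * w) = 1)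
    (hΛ : ∫ n : ↥N, f.toFun (w * (n : G) * w) ∂μ = 0) : False :=
  integral_conj_toFun_ne_zero_of_cells H τ N B μ hN hBo hBc w hw θ f heig hf1 R hwit hcells hθ hΛ

end Summit.HodgeConjecture.HodgeConjecture.Cruxes.H413.K2E3BranchAContradictionCells

end
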